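import Mathlib.Data.Real.Basic
import Mathlib.Data.List.Range
import Mathlib.Data.List.GetD
import Mathlib.Tactic
import HarnessLib

/-!
# A cyclic-scheduling certificate checker for planar-heights kissing rows (integers only), with soundness

HONEST FRAMING. Part of the venture `Summits/Ventures/Crystal3D` (cell `crystal3d-full`), helper
`--supports` the crux `CoaxialWallLaw` (stmt-Ventures-19481, `route-Ventures-StickyWulffConstant`),
REGISTERED line `WallLedgerF`, open stub `stub_coaxialTwoSlabAdhesion`.  RUNG CREDIT ONLY; F-C1 not moved.
Pure combinatorics, no geometry: the kernel side of the (F-γ) bi-planar row `BiPlanarEndRow τ`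
(`…CoaxialWallLawBiPlanarRowDefs`).

THE ABSTRACT PROBLEM.  `N` points on a circle, point `i` of SPECIES `s i < S`, at positions
`0 = θ₀ ≤ θ₁ ≤ … ≤ θ_{N−1} < T` (any real unit; `T` = the full turn), with the SEPARATION RULE: for `i < j` both
arcs between `i` and `j` are at least `δ(s i, s j)`:  `θ j − θ i ≥ δ` and `θ i + T − θ j ≥ δ`, and at most `cap a`
points of species `a`.  (For the row: species = frame heights, `θ` = azimuths scaled to integers units, `δ` =
certified integer LOWER bounds of the pairwise azimuth separations forced by `dist ≥ 1`, `T` an integer UPPER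
bound of the full turn, `cap root = 5` by hexagon rigidity.)

THE CHECKER `azSearch tbl T cap root N` (all data integers): depth-first over species sequences starting with
`root`; a child is PRUNED when its species cap is exhausted or when Floyd–Warshall on the difference constraints
of the prefix finds a positive cycle (`azInfeasible`); it returns `true` iff no sequence of length `N` survives.
SOUNDNESS `azSearch_sound`: `azSearch … = true` ⇒ no configuration of `N` points exists.  Evaluation is by
`decide`/`native_decide` in the row files; this file proves nothing about any particular table.
-/

namespace Summit.Ventures.Crystal3D.Theorems

/-! ## The checker -/

/-- Table lookup `tbl[a][b]` (default `0`); also used for the bound matrices. -/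
def azGet (tbl : List (List ℤ)) (a b : ℕ) : ℤ := (tbl.getD a []).getD b 0

/-- Tabulate an `n × n` integer matrix from a function (`azGet_azMk`). -/
def azMk (n : ℕ) (f : ℕ → ℕ → ℤ) : List (List ℤ) :=
  (List.range n).map fun i => (List.range n).map fun j => f i j

/-- The base difference-constraint matrix of a species sequence: entry `(i, j)` is a lower bound on
`θ j − θ i` (`δ` forward, `δ − T` backward, `0` on the diagonal). -/
def azBase (tbl : List (List ℤ)) (T : ℤ) (seq : List ℕ) (i j : ℕ) : ℤ :=
  if i < j then azGet tbl (seq.getD i 0) (seq.getD j 0)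
  else if j < i then azGet tbl (seq.getD j 0) (seq.getD i 0) - T
  else 0

/-- One Floyd–Warshall relaxation of the matrix `M` through the pivot `k`. -/
def azStep (n k : ℕ) (M : List (List ℤ)) : List (List ℤ) :=
  azMk n fun i j => max (azGet M i j) (azGet M i k + azGet M k j)

/-- `k` rounds of Floyd–Warshall (pivots `0, …, k−1`). -/
def azFW (n : ℕ) : ℕ → List (List ℤ) → List (List ℤ)
  | 0, M => M
  | k + 1, M => azStep n k (azFW n k M)

/-- **Infeasibility test**: a positive diagonal entry after Floyd–Warshall. -/
def azInfeasible (tbl : List (List ℤ)) (T : ℤ) (seq : List ℕ) : Bool :=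
  let n := seq.length
  let M := azFW n n (azMk n (azBase tbl T seq))
  (List.range n).any fun i => decide (0 < azGet M i i)

/-- **The depth-first search** (`fuel` = points still to place): `true` iff every completion is pruned. -/
def azSearchGo (tbl : List (List ℤ)) (T : ℤ) (cap : List ℕ) : ℕ → List ℕ → Bool
  | 0, _ => false
  | fuel + 1, pre => (List.range tbl.length).all fun a =>
      decide (cap.getD a 0 ≤ pre.count a) || azInfeasible tbl T (pre ++ [a]) ||
        azSearchGo tbl T cap fuel (pre ++ [a])

/-- **The checker**: no `N`-point configuration whose first point has species `root`. -/
def azSearch (tbl : List (List ℤ)) (T : ℤ) (cap : List ℕ) (root N : ℕ) : Bool :=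
  azSearchGo tbl T cap (N - 1) [root]

/-! ## Soundness -/

/-- The tabulated matrix agrees with the function on indices `< n`. -/
theorem azGet_azMk (n : ℕ) (f : ℕ → ℕ → ℤ) {i j : ℕ} (hi : i < n) (hj : j < n) :
    azGet (azMk n f) i j = f i j := by
  have h1 : (azMk n f).getD i [] = (List.range n).map fun j => f i j := by
    unfold azMk
    rw [List.getD_eq_getElem _ _ (by simpa using hi), List.getElem_map, List.getElem_range]
  have h2 : ((List.range n).map fun j => f i j).getD j 0 = f i j := by
    rw [List.getD_eq_getElem _ _ (by simpa using hj), List.getElem_map, List.getElem_range]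
  unfold azGet
  rw [h1, h2]

/-- A matrix of valid lower bounds on the differences `θ j − θ i`, `i, j < n`. -/
def AzValid (n : ℕ) (M : List (List ℤ)) (θ : ℕ → ℝ) : Prop :=
  ∀ i j, i < n → j < n → ((azGet M i j : ℤ) : ℝ) ≤ θ j - θ i

/-- A Floyd–Warshall relaxation preserves validity. -/
theorem azValid_step {n k : ℕ} {M : List (List ℤ)} {θ : ℕ → ℝ} (hk : k < n) (h : AzValid n M θ) :
    AzValid n (azStep n k M) θ := by
  intro i j hi hj
  unfold azStep
  rw [azGet_azMk n _ hi hj]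
  have h1 := h i j hi hj
  have h2 := h i k hi hk
  have h3 := h k j hk hj
  rw [Int.cast_max]
  refine max_le h1 ?_
  push_cast
  linarith

/-- Floyd–Warshall preserves validity. -/
theorem azValid_fw {n : ℕ} {M : List (List ℤ)} {θ : ℕ → ℝ} (h : AzValid n M θ) :
    ∀ k, k ≤ n → AzValid n (azFW n k M) θ
  | 0, _ => h
  | k + 1, hk => by
      have ih := azValid_fw h k (Nat.le_of_succ_le hk)
      exact azValid_step (Nat.lt_of_succ_le hk) ih

/-- Under valid base bounds the infeasibility test does not fire. -/
theorem azInfeasible_false_of_valid {tbl : List (List ℤ)} {T : ℤ} {seq : List ℕ} {θ : ℕ → ℝ}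
    (h : AzValid seq.length (azMk seq.length (azBase tbl T seq)) θ) : azInfeasible tbl T seq = false := by
  by_contra hne
  have htrue : azInfeasible tbl T seq = true := by
    cases hb : azInfeasible tbl T seq
    · exact absurd hb hne
    · rfl
  unfold azInfeasible at htrue
  simp only [List.any_eq_true, List.mem_range, decide_eq_true_eq] at htrue
  obtain ⟨i, hi, hpos⟩ := htrue
  have hv := azValid_fw h seq.length le_rfl i i hi hi
  have : ((0 : ℤ) : ℝ) <
      ((azGet (azFW seq.length seq.length (azMk seq.length (azBase tbl T seq))) i i : ℤ) : ℝ) := by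
    exact_mod_cast hpos
  push_cast at this
  linarith

/-- The base matrix of a prefix of an admissible configuration is valid. -/
theorem azValid_base {tbl : List (List ℤ)} {T : ℤ} {s : ℕ → ℕ} {θ : ℕ → ℝ} {N n : ℕ} (hn : n ≤ N)
    (hsep : ∀ i j, i < j → j < N →
      ((azGet tbl (s i) (s j) : ℤ) : ℝ) ≤ θ j - θ i ∧ ((azGet tbl (s i) (s j) : ℤ) : ℝ) ≤ θ i + T - θ j) :
    AzValid ((List.range n).map s).length
      (azMk ((List.range n).map s).length (azBase tbl T ((List.range n).map s))) θ := by
  intro i j hi hj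
  rw [azGet_azMk _ _ hi hj]
  rw [List.length_map, List.length_range] at hi hj
  have hgi : ((List.range n).map s).getD i 0 = s i := by
    rw [List.getD_eq_getElem _ _ (by simpa using hi), List.getElem_map, List.getElem_range]
  have hgj : ((List.range n).map s).getD j 0 = s j := by
    rw [List.getD_eq_getElem _ _ (by simpa using hj), List.getElem_map, List.getElem_range]
  unfold azBase
  rw [hgi, hgj]
  by_cases hij : i < j
  · rw [if_pos hij]
    exact (hsep i j hij (lt_of_lt_of_le hj hn)).1
  · rw [if_neg hij]
    by_cases hji : j < i
    · rw [if_pos hji]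
      have := (hsep j i hji (lt_of_lt_of_le hi hn)).2
      push_cast
      linarith
    · rw [if_neg hji]
      have : i = j := by omega
      subst this
      push_cast
      linarith

/-- **Soundness of the search.** -/
theorem azSearchGo_sound {tbl : List (List ℤ)} {T : ℤ} {cap : List ℕ} {s : ℕ → ℕ} {θ : ℕ → ℝ} {N : ℕ}
    (hsS : ∀ i < N, s i < tbl.length)
    (hsep : ∀ i j, i < j → j < N →
      ((azGet tbl (s i) (s j) : ℤ) : ℝ) ≤ θ j - θ i ∧ ((azGet tbl (s i) (s j) : ℤ) : ℝ) ≤ θ i + T - θ j)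
    (hcap : ∀ a, ((List.range N).map s).count a ≤ cap.getD a 0) :
    ∀ fuel n, n + fuel = N → azSearchGo tbl T cap fuel ((List.range n).map s) = true → False
  | 0, n, _, h => by simp [azSearchGo] at h
  | fuel + 1, n, hn, h => by
      unfold azSearchGo at h
      rw [List.all_eq_true] at h
      have hnN : n < N := by omega
      have ha := h (s n) (List.mem_range.2 (hsS n hnN))
      simp only [Bool.or_eq_true, decide_eq_true_eq] at ha
      have hpre : (List.range n).map s ++ [s n] = (List.range (n + 1)).map s := by
        rw [List.range_succ, List.map_append, List.map_singleton]
      rcases ha with (hc | hinf) | hrec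
      · -- cap exhausted: but point `n` itself has species `s n`
        have hsub : List.Sublist ((List.range (n + 1)).map s) ((List.range N).map s) :=
          (List.range_sublist.2 (by omega)).map s
        have h1 : ((List.range (n + 1)).map s).count (s n) ≤ ((List.range N).map s).count (s n) :=
          hsub.count_le _
        have h2 : ((List.range (n + 1)).map s).count (s n) = ((List.range n).map s).count (s n) + 1 := by
          rw [← hpre, List.count_append, List.count_singleton_self]
        have h3 := hcap (s n)
        omega
      · -- Floyd–Warshall fired on a valid system
        rw [hpre] at hinf
        have hv := azValid_base (tbl := tbl) (T := T) (s := s) (θ := θ) (n := n + 1) (by omega) hsep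
        rw [azInfeasible_false_of_valid hv] at hinf
        exact Bool.false_ne_true hinf
      · rw [hpre] at hrec
        exact azSearchGo_sound hsS hsep hcap fuel (n + 1) (by omega) hrec

/-- **SOUNDNESS OF THE CHECKER.**  If `azSearch tbl T cap root N = true` then there is no configuration of `N`
points on the circle — species `s i < #tbl`, `s 0 = root`, positions `θ` with `θ 0 = 0`, both arcs of every
pair `i < j < N` at least `tbl[s i][s j]` (forward `θ j − θ i`, backward `θ i + T − θ j`), and at most
`cap a` points of each species `a`. -/
theorem azSearch_sound {tbl : List (List ℤ)} {T : ℤ} {cap : List ℕ} {root N : ℕ}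
    (h : azSearch tbl T cap root N = true) (hN : 1 ≤ N)
    (s : ℕ → ℕ) (θ : ℕ → ℝ) (hsS : ∀ i < N, s i < tbl.length) (hs0 : s 0 = root)
    (hsep : ∀ i j, i < j → j < N →
      ((azGet tbl (s i) (s j) : ℤ) : ℝ) ≤ θ j - θ i ∧ ((azGet tbl (s i) (s j) : ℤ) : ℝ) ≤ θ i + T - θ j)
    (hcap : ∀ a, ((List.range N).map s).count a ≤ cap.getD a 0) : False := by
  unfold azSearch at h
  have hpre : [root] = (List.range 1).map s := by
    rw [List.range_one, List.map_singleton, hs0]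
  rw [hpre] at h
  exact azSearchGo_sound hsS hsep hcap (N - 1) 1 (by omega) h

end Summit.Ventures.Crystal3D.Theorems
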